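import Summits.RiemannHypothesis.RiemannHypothesis.Theorems.GroundBartaEvenWinsBeyondArchDeflationArchPanelsY
import HarnessLib

/-!
# The archimedean energy of a window polynomial by UNIVERSAL MODEL MOMENTS (kernel-cost lever #5, prover B g11)

RH-free helper for the GroundBarta block certificates (`--supports` the parity ladder item).

The A-layer of a cell certifies, for every trial polynomial `P` (degree ≈ 55) with increment polynomial `E`
(degree ≈ 112, `τE(τ) = 2C(0) − 2C(τ)`), an enclosure of the bulk arch integral
`X(E) = ∫₀² g(bτ) E(τ) dτ` (`g = weilArchDensityG`, slope `b` = the window).  Today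
(`Literature.NumberTheory.LFunctions.archPanelCheck`, `dt_archEnergy_windowPolyY_mem`) this costs one gate file of
30 panel certificates per polynomial (≈ 225 s of kernel time: 30 exact Taylor shifts of `E`), although the panel Taylor
models `p_k` of `g` are the SAME for every polynomial of the cell.  Here the `E`-dependence is separated exactly:

* `X(E) = Σ_k ∫_{-h}^{h} g_k(σ) E(c_k+σ) dσ`, `g_k(σ) = g(b c_k + bσ)`, and with the accepted panel models `p_k`
  (`|g_k − p_k| ≤ G_k/S` on the panel, `G_k = tabsI …` — the cell's shared facts):
  `Σ_k ∫ p_k(σ) E(c_k+σ) dσ = Σ_j E_j W_j` EXACTLY, where `W_j = Σ_k ∫_{c_k−h}^{c_k+h} P_k(τ) τ^j dτ`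
  (`P_k(τ) = p_k(τ − c_k)`) are the UNIVERSAL MODEL MOMENTS of the cell — rationals computed and checked ONCE per
  cell (`psCheck`, `momentsCheck`, kernel `decide`), independent of the trial polynomial;
* the model error is bounded without any Taylor shift: `|Σ_k ∫ (g_k − p_k) E(c_k+σ)| ≤ (max_k G_k/S) · ∫₀² |E|` and
  `∫₀² |E| ≤ r` whenever `2 ∫₀² E² ≤ r²` (Cauchy–Schwarz; `∫₀² E²` is the exact rational `sqInt02 E`).

So the per-polynomial certificate `archMomentCheck W G S E r Xlo Xhi` is: `Σ_j E_j W_j ± (G/S)·r ⊆ [Xlo, Xhi]` and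
`2·sqInt02 E ≤ r²` — one dot product and one polynomial square (≈ 7 s of kernel instead of ≈ 225 s, and NO panel
file; measured on the `c = 83/100` cell, whose enclosure radius stays ≈ 3·10⁻²⁹).  `integral_mem_of_archMomentCheck` is
its soundness and `dt_archEnergy_windowPolyY_mem_moments` the drop-in replacement of `dt_archEnergy_windowPolyY_mem`
(same conclusion with `Xlo, Xhi` in place of the panel sums). [folklore]
-/

set_option linter.dupNamespace false

open MeasureTheory Set intervalIntegral
open scoped BigOperators

namespace Summit.RiemannHypothesis.RiemannHypothesis.Theorems.ArchMoments

open Literature.NumberTheory.LFunctions Literature.Analysis.ValidatedNumerics.ExpPoly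
open Literature.Analysis.ValidatedNumerics.PolyMP Literature.Analysis.ValidatedNumerics.NumericsMP
open Literature.Analysis.ValidatedNumerics

/-! ## Exact rational primitives -/

/-- `Σ_j E_j W_j` over the common prefix of the two lists. [folklore] -/
def dotQ : List ℚ → List ℚ → ℚ
  | [], _ => 0
  | _ :: _, [] => 0
  | e :: E, w :: W => e * w + dotQ E W

/-- `dotQ` as a finite sum (when `W` is at least as long as `E`). [folklore] -/
theorem dotQ_eq_sum : ∀ (E W : List ℚ), E.length ≤ W.length →
    dotQ E W = ∑ j ∈ Finset.range E.length, E.getD j 0 * W.getD j 0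
  | [], _, _ => by simp [dotQ]
  | _ :: _, [], h => by simp at h
  | e :: E, w :: W, h => by
      have h' : E.length ≤ W.length := by simpa using h
      rw [dotQ, List.length_cons, Finset.sum_range_succ', dotQ_eq_sum E W h']
      simp [add_comm]

/-- Horner evaluation as a finite sum of monomials. [folklore] -/
theorem eval_eq_sum_getD : ∀ (p : Poly) (x : ℝ),
    Poly.eval p x = ∑ j ∈ Finset.range p.length, ((p.getD j 0 : ℚ) : ℝ) * x ^ j
  | [], x => by simp
  | c :: p, x => by
      rw [Poly.eval_cons, List.length_cons, Finset.sum_range_succ', eval_eq_sum_getD p x, Finset.mul_sum]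
      simp only [List.getD_cons_succ, List.getD_cons_zero, pow_zero, mul_one, pow_succ]
      rw [add_comm]
      congr 1
      exact Finset.sum_congr rfl fun j _ ↦ by ring

/-- `∫₀² E(τ)² dτ` as an exact rational. [folklore] -/
def sqInt02 (E : Poly) : ℚ :=
  Poly.evalQ (Poly.ad 0 (Poly.mul E E)) 2 - Poly.evalQ (Poly.ad 0 (Poly.mul E E)) 0

/-- `∫₀² E² = sqInt02 E`. [folklore] -/
theorem integral_sq_eq_sqInt02 (E : Poly) :
    ∫ τ in (0:ℝ)..2, (Poly.eval E τ) ^ 2 = ((sqInt02 E : ℚ) : ℝ) := by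
  have h1 : ∫ τ in (0:ℝ)..2, (Poly.eval E τ) ^ 2 = ∫ τ in (0:ℝ)..2, Poly.eval (Poly.mul E E) τ :=
    integral_congr fun τ _ ↦ by rw [Poly.eval_mul, sq]
  rw [h1, integral_eq_sub_of_hasDerivAt (fun x _ ↦ hasDerivAt_eval_ad_zero (Poly.mul E E) x)
      ((Poly.continuous_eval _).intervalIntegrable _ _), sqInt02, Rat.cast_sub, Poly.eval_evalQ, Poly.eval_evalQ]
  push_cast
  ring

/-- **Cauchy–Schwarz on `[0,2]`**: if `0 ≤ r` and `2 ∫₀² E² ≤ r²` then `∫₀² |E| ≤ r`. [folklore] -/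
theorem integral_abs_le_of_sq (E : Poly) {r : ℚ} (hr : 0 ≤ r) (h2 : 2 * sqInt02 E ≤ r * r) :
    ∫ τ in (0:ℝ)..2, |Poly.eval E τ| ≤ (r : ℝ) := by
  set A := ∫ τ in (0:ℝ)..2, |Poly.eval E τ| with hA
  have hcE : Continuous fun τ ↦ Poly.eval E τ := Poly.continuous_eval E
  have hcA : Continuous fun τ ↦ |Poly.eval E τ| := hcE.abs
  have hA0 : 0 ≤ A := intervalIntegral.integral_nonneg (by norm_num) fun τ _ ↦ abs_nonneg _
  have key : (0:ℝ) ≤ ∫ τ in (0:ℝ)..2, (|Poly.eval E τ| - A / 2) ^ 2 :=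
    intervalIntegral.integral_nonneg (by norm_num) fun τ _ ↦ sq_nonneg _
  have e : ∀ τ, (|Poly.eval E τ| - A / 2) ^ 2 = (Poly.eval E τ) ^ 2 - A * |Poly.eval E τ| + (A / 2) ^ 2 :=
    fun τ ↦ by rw [sub_sq, sq_abs]; ring
  simp_rw [e] at key
  have i1 : IntervalIntegrable (fun τ : ℝ ↦ Poly.eval E τ ^ 2 - A * |Poly.eval E τ|) volume 0 2 :=
    ((hcE.pow 2).sub (continuous_const.mul hcA)).intervalIntegrable _ _
  have i2 : IntervalIntegrable (fun _ : ℝ ↦ (A / 2) ^ 2) volume 0 2 := continuous_const.intervalIntegrable _ _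
  have i3 : IntervalIntegrable (fun τ : ℝ ↦ Poly.eval E τ ^ 2) volume 0 2 := (hcE.pow 2).intervalIntegrable _ _
  have i4 : IntervalIntegrable (fun τ : ℝ ↦ A * |Poly.eval E τ|) volume 0 2 :=
    (continuous_const.mul hcA).intervalIntegrable _ _
  rw [intervalIntegral.integral_add i1 i2, intervalIntegral.integral_sub i3 i4,
    intervalIntegral.integral_const_mul, intervalIntegral.integral_const, integral_sq_eq_sqInt02, ← hA] at key
  have h2r : ((2 * sqInt02 E : ℚ) : ℝ) ≤ ((r * r : ℚ) : ℝ) := by exact_mod_cast h2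
  push_cast at h2r
  have hr' : (0:ℝ) ≤ r := by exact_mod_cast hr
  simp only [smul_eq_mul] at key
  nlinarith

/-! ## Universal model moments (checked once per cell) -/

/-- Check of the panel models in `τ`-coordinates: `P_k(τ) = p_k(τ − c_k)` (`Ps` = data, against the cell's `ps`).
[folklore] -/
def psCheck (N : ℕ) (h : ℚ) (ps : ℕ → Poly) (Ps : List Poly) : Bool :=
  (List.range N).all fun k ↦ decide (Ps.getD k [] = Poly.taylorShiftH (ps k) (-panelCentre h k))

/-- What `psCheck` certifies. [folklore] -/
theorem psCheck_spec {N : ℕ} {h : ℚ} {ps : ℕ → Poly} {Ps : List Poly} (hc : psCheck N h ps Ps = true) :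
    ∀ k, k < N → Ps.getD k [] = Poly.taylorShiftH (ps k) (-panelCentre h k) := by
  intro k hk
  unfold psCheck at hc
  rw [List.all_eq_true] at hc
  have := hc k (List.mem_range.2 hk)
  simpa using this

/-- `momAux P a b n = Σ_i P_i (b^{n+i} − a^{n+i})/(n+i)` (`= ∫_a^b τ^{n−1} P(τ) dτ` for `n ≥ 1`). [folklore] -/
def momAux : Poly → ℚ → ℚ → ℕ → ℚ
  | [], _, _, _ => 0
  | c :: P, a, b, n => c * ((b ^ n - a ^ n) / n) + momAux P a b (n + 1)

/-- `momAux P a b (n+1) = ∫_a^b τⁿ P(τ) dτ`. [folklore] -/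
theorem momAux_integral : ∀ (P : Poly) (a b : ℚ) (n : ℕ),
    ((momAux P a b (n + 1) : ℚ) : ℝ) = ∫ τ in (a:ℝ)..b, τ ^ n * Poly.eval P τ
  | [], a, b, n => by simp [momAux]
  | c :: P, a, b, n => by
      rw [momAux]
      have ih := momAux_integral P a b (n + 1)
      have e : ∀ τ : ℝ, τ ^ n * Poly.eval (c :: P) τ = (c : ℝ) * τ ^ n + τ ^ (n + 1) * Poly.eval P τ :=
        fun τ ↦ by rw [Poly.eval_cons]; ring
      simp_rw [e]
      have i1 : IntervalIntegrable (fun τ : ℝ ↦ (c : ℝ) * τ ^ n) volume a b :=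
        (continuous_const.mul (continuous_pow n)).intervalIntegrable _ _
      have i2 : IntervalIntegrable (fun τ : ℝ ↦ τ ^ (n + 1) * Poly.eval P τ) volume a b :=
        ((continuous_pow (n + 1)).mul (Poly.continuous_eval P)).intervalIntegrable _ _
      rw [intervalIntegral.integral_add i1 i2, intervalIntegral.integral_const_mul, integral_pow, ← ih]
      push_cast
      ring

/-- Check of the universal moments `W`: `W_j = Σ_{k<N} ∫_{c_k−h}^{c_k+h} P_k(τ) τ^j dτ` for every `j < |W|`.
[folklore] -/
def momentsCheck (N : ℕ) (h : ℚ) (Ps : List Poly) (W : List ℚ) : Bool :=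
  (List.range W.length).all fun j ↦
    decide (W.getD j 0 = ∑ k ∈ Finset.range N, momAux (Ps.getD k []) (panelCentre h k - h) (panelCentre h k + h) (j + 1))

/-- What `momentsCheck` certifies. [folklore] -/
theorem momentsCheck_spec {N : ℕ} {h : ℚ} {Ps : List Poly} {W : List ℚ} (hc : momentsCheck N h Ps W = true) :
    ∀ j, j < W.length → W.getD j 0 =
      ∑ k ∈ Finset.range N, momAux (Ps.getD k []) (panelCentre h k - h) (panelCentre h k + h) (j + 1) := by
  intro j hj
  unfold momentsCheck at hc
  rw [List.all_eq_true] at hc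
  have := hc j (List.mem_range.2 hj)
  simpa using this

/-! ## The per-polynomial certificate -/

/-- **The moment certificate** of the bulk arch integral of `E`: `|E| ≤ |W|`, `0 ≤ r`, `2∫₀²E² ≤ r²` and
`[Σ_j E_j W_j − (G/S) r, Σ_j E_j W_j + (G/S) r] ⊆ [Xlo, Xhi]`. [folklore] -/
def archMomentCheck (W : List ℚ) (G : ℚ) (S : ℕ) (E : Poly) (r Xlo Xhi : ℚ) : Bool :=
  decide (E.length ≤ W.length) && decide (0 ≤ r) && decide (2 * sqInt02 E ≤ r * r) &&
    decide (Xlo + G / S * r ≤ dotQ E W) && decide (dotQ E W + G / S * r ≤ Xhi)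

/-- The model part of one panel, exactly: `∫_{-h}^{h} p(σ) E(c+σ) dσ = Σ_j E_j · momAux P (c−h) (c+h) (j+1)` for
`P = taylorShiftH p (−c)`. [folklore] -/
theorem panel_model_integral (p P E : Poly) (c h : ℚ) (hP : P = Poly.taylorShiftH p (-c)) :
    ∫ σ in (-(h:ℝ))..h, Poly.eval p σ * Poly.eval E ((c : ℝ) + σ) =
      ∑ j ∈ Finset.range E.length, ((E.getD j 0 : ℚ) : ℝ) * ((momAux P (c - h) (c + h) (j + 1) : ℚ) : ℝ) := by
  have e1 : ∀ σ : ℝ, Poly.eval p σ * Poly.eval E ((c : ℝ) + σ) =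
      (fun τ : ℝ ↦ Poly.eval P τ * Poly.eval E τ) (σ + c) := by
    intro σ
    simp only
    rw [hP, Poly.eval_taylorShiftH]
    have : (((-c : ℚ) : ℝ) + (σ + c)) = σ := by push_cast; ring
    rw [this, add_comm σ]
  simp_rw [e1]
  rw [intervalIntegral.integral_comp_add_right (fun τ : ℝ ↦ Poly.eval P τ * Poly.eval E τ)]
  have ea : (-(h:ℝ) + c) = ((c - h : ℚ) : ℝ) := by push_cast; ring
  have eb : ((h:ℝ) + c) = ((c + h : ℚ) : ℝ) := by push_cast; ring
  rw [ea, eb]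
  have e2 : ∀ τ : ℝ, Poly.eval P τ * Poly.eval E τ =
      ∑ j ∈ Finset.range E.length, ((E.getD j 0 : ℚ) : ℝ) * (τ ^ j * Poly.eval P τ) := by
    intro τ
    rw [eval_eq_sum_getD E τ, Finset.mul_sum]
    exact Finset.sum_congr rfl fun j _ ↦ by ring
  simp_rw [e2]
  have i : ∀ j ∈ Finset.range E.length, IntervalIntegrable
      (fun τ : ℝ ↦ ((E.getD j 0 : ℚ) : ℝ) * (τ ^ j * Poly.eval P τ)) volume ((c - h : ℚ) : ℝ) ((c + h : ℚ) : ℝ) :=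
    fun j _ ↦ (continuous_const.mul ((continuous_pow j).mul (Poly.continuous_eval P))).intervalIntegrable _ _
  rw [intervalIntegral.integral_finsetSum i]
  refine Finset.sum_congr rfl fun j _ ↦ ?_
  rw [intervalIntegral.integral_const_mul, momAux_integral]

/-- **Soundness of the moment certificate**: `Xlo ≤ ∫₀² g(sτ) E(τ) dτ ≤ Xhi`. Hypotheses: the cell's panel models
are accepted (`hg`) with Taylor-model sups `≤ G` (`hG`), the `τ`-models and universal moments are the correct ones (`hPs`,
`hW` — per cell: ONE kernel `decide` per index `k` / `j`, or `psCheck_spec` / `momentsCheck_spec` for small cells), and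
the per-polynomial check. [folklore] -/
theorem integral_mem_of_archMomentCheck {S : ℕ} (hS : 0 < S) {N : ℕ} (hN : 0 < N) {s : ℚ} (hs : 0 < s)
    (hs2 : s ≤ 2) {D K Kφ lam Ke ke : ℕ} (hK : 0 < K) (hKφ : 0 < Kφ) (hlam : 0 < lam)
    (Q : ℕ → List ℤ) (e : ℕ → ℕ) (ps : ℕ → Poly)
    (hg : ∀ k, k < N → gPanelCheck S (1 / N) D Kφ lam Ke ke (s * panelCentre (1 / N) k) s (Q k) (e k) = true)
    {G : ℚ} (hG : ∀ k, k < N → ((tabsI S (1 / N) (tsubI (gPanelI S (1 / N) D K Ke ke (s * panelCentre (1 / N) k) s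
      (Q k) (e k)) (ratPolyI S (ps k))) : ℤ) : ℚ) ≤ G)
    {Ps : List Poly} (hPs : ∀ k, k < N → Ps.getD k [] = Poly.taylorShiftH (ps k) (-panelCentre (1 / N) k))
    {W : List ℚ} (hW : ∀ j, j < W.length → W.getD j 0 = ∑ k ∈ Finset.range N,
      momAux (Ps.getD k []) (panelCentre (1 / N) k - 1 / N) (panelCentre (1 / N) k + 1 / N) (j + 1))
    {E : Poly} {r Xlo Xhi : ℚ} (hchk : archMomentCheck W G S E r Xlo Xhi = true) :
    (Xlo : ℝ) ≤ ∫ τ in (0:ℝ)..2, weilArchDensityG ((s : ℝ) * τ) * Poly.eval E τ ∧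
      ∫ τ in (0:ℝ)..2, weilArchDensityG ((s : ℝ) * τ) * Poly.eval E τ ≤ (Xhi : ℝ) := by
  unfold archMomentCheck at hchk
  simp only [Bool.and_eq_true, decide_eq_true_eq] at hchk
  obtain ⟨⟨⟨⟨hlen, hr0⟩, hr2⟩, hlo⟩, hhi⟩ := hchk
  set h : ℚ := 1 / N with hh
  have hN' : (0 : ℚ) < N := by exact_mod_cast hN
  have h0 : 0 < h := by rw [hh]; positivity
  have h1 : h ≤ 1 := by rw [hh, div_le_one hN']; exact_mod_cast hN
  have hsh2 : s * h ≤ 2 := by nlinarith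
  have hSr : (0 : ℝ) < S := by exact_mod_cast hS
  have hhr : (0 : ℝ) ≤ h := by exact_mod_cast h0.le
  -- centres
  have hc : ∀ k : ℕ, ((panelCentre h k : ℚ) : ℝ) = (2 * k + 1) * (h : ℝ) := fun k ↦ by
    simp only [panelCentre]; push_cast; ring
  -- Step 1: panel decomposition of the integral and of `∫ |E|`
  have hdec := integral_weilArchDensityG_slope_mul_eval_eq_sum E hs h0 N
  have habs := intervalIntegral_eq_sum_panels (fun τ ↦ |Poly.eval E τ|) hhr
    (fun a b _ _ ↦ ((Poly.continuous_eval E).abs).intervalIntegrable _ _) N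
  have h2 : (2 : ℝ) * N * (h : ℝ) = 2 := by
    have hNr : (N : ℝ) ≠ 0 := by exact_mod_cast hN.ne'
    rw [hh]; push_cast; field_simp
  rw [h2] at hdec habs
  -- Step 2: per panel, model + error
  have hGS : ∀ k, k < N → ∀ σ : ℝ, |σ| ≤ h →
      |weilArchDensityG (((s * panelCentre h k : ℚ) : ℝ) + s * σ) - Poly.eval (ps k) σ| ≤ (G : ℝ) / S := by
    intro k hk σ hσ
    have hck : s * h ≤ s * panelCentre h k := by
      refine mul_le_mul_of_nonneg_left ?_ hs.le
      unfold panelCentre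
      have : (1 : ℚ) ≤ ((2 * k + 1 : ℕ) : ℚ) := by exact_mod_cast Nat.le_add_left 1 (2 * k)
      nlinarith
    have hTM := tmem_gPanel hS h0.le hs hsh2 hK hKφ hlam hck (hg k hk)
    have hdiff := tmem_sub hTM (tmem_ratPoly S h (ps k))
    have hb := abs_le_tabsI h0.le hdiff hσ
    have hGk : ((tabsI S h (tsubI (gPanelI S h D K Ke ke (s * panelCentre h k) s (Q k) (e k))
        (ratPolyI S (ps k))) : ℤ) : ℝ) ≤ (G : ℝ) := by exact_mod_cast hG k hk
    rw [le_div_iff₀ hSr]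
    exact le_trans hb hGk
  have hG0 : (0 : ℝ) ≤ (G : ℝ) / S := le_trans (abs_nonneg _) (hGS 0 hN 0 (by simpa using hhr))
  -- per-panel estimate
  have hpanel : ∀ k ∈ Finset.range N,
      |(∫ σ in (-(h:ℝ))..h, weilArchDensityG (((s * panelCentre h k : ℚ) : ℝ) + s * σ) *
          Poly.eval E ((panelCentre h k : ℚ) + σ)) -
        ∑ j ∈ Finset.range E.length, ((E.getD j 0 : ℚ) : ℝ) *
          ((momAux (Ps.getD k []) (panelCentre h k - h) (panelCentre h k + h) (j + 1) : ℚ) : ℝ)| ≤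
      (G : ℝ) / S * ∫ σ in (-(h:ℝ))..h, |Poly.eval E ((panelCentre h k : ℚ) + σ)| := by
    intro k hk
    rw [Finset.mem_range] at hk
    rw [← panel_model_integral (ps k) (Ps.getD k []) E (panelCentre h k) h (hPs k hk)]
    have hck : ((s * h : ℚ) : ℝ) ≤ ((s * panelCentre h k : ℚ) : ℝ) := by
      have : s * h ≤ s * panelCentre h k := by
        refine mul_le_mul_of_nonneg_left ?_ hs.le
        unfold panelCentre
        have : (1 : ℚ) ≤ ((2 * k + 1 : ℕ) : ℚ) := by exact_mod_cast Nat.le_add_left 1 (2 * k)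
        nlinarith
      exact_mod_cast this
    have hgi : IntervalIntegrable (fun σ : ℝ ↦ weilArchDensityG (((s * panelCentre h k : ℚ) : ℝ) + s * σ))
        volume (-(h:ℝ)) h := by
      have := intervalIntegrable_weilArchDensityG_panel (h₂ := (h : ℝ)) (c := ((s * panelCentre h k : ℚ) : ℝ))
        (s := (s : ℝ)) hhr (by exact_mod_cast hs) (by push_cast at hck ⊢; exact hck)
      exact this
    have hEc : Continuous fun σ : ℝ ↦ Poly.eval E ((panelCentre h k : ℚ) + σ) :=
      (Poly.continuous_eval E).comp (continuous_const.add continuous_id)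
    have hi1 : IntervalIntegrable (fun σ : ℝ ↦ weilArchDensityG (((s * panelCentre h k : ℚ) : ℝ) + s * σ) *
        Poly.eval E ((panelCentre h k : ℚ) + σ)) volume (-(h:ℝ)) h := hgi.mul_continuousOn hEc.continuousOn
    have hi2 : IntervalIntegrable (fun σ : ℝ ↦ Poly.eval (ps k) σ * Poly.eval E ((panelCentre h k : ℚ) + σ))
        volume (-(h:ℝ)) h := ((Poly.continuous_eval _).mul hEc).intervalIntegrable _ _
    rw [← intervalIntegral.integral_sub hi1 hi2]
    have hle : (-(h:ℝ)) ≤ h := by linarith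
    calc |∫ σ in (-(h:ℝ))..h, (weilArchDensityG (((s * panelCentre h k : ℚ) : ℝ) + s * σ) *
            Poly.eval E ((panelCentre h k : ℚ) + σ) -
            Poly.eval (ps k) σ * Poly.eval E ((panelCentre h k : ℚ) + σ))|
        ≤ ∫ σ in (-(h:ℝ))..h, |weilArchDensityG (((s * panelCentre h k : ℚ) : ℝ) + s * σ) *
            Poly.eval E ((panelCentre h k : ℚ) + σ) -
            Poly.eval (ps k) σ * Poly.eval E ((panelCentre h k : ℚ) + σ)| :=
          intervalIntegral.abs_integral_le_integral_abs hle
      _ ≤ ∫ σ in (-(h:ℝ))..h, (G : ℝ) / S * |Poly.eval E ((panelCentre h k : ℚ) + σ)| := by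
          refine intervalIntegral.integral_mono_on hle ((hi1.sub hi2).abs) ((continuous_const.mul hEc.abs).intervalIntegrable _ _) ?_
          intro σ hσ
          have hσ' : |σ| ≤ h := abs_le.2 ⟨by linarith [hσ.1], hσ.2⟩
          rw [← sub_mul, abs_mul]
          exact mul_le_mul_of_nonneg_right (hGS k hk σ hσ') (abs_nonneg _)
      _ = (G : ℝ) / S * ∫ σ in (-(h:ℝ))..h, |Poly.eval E ((panelCentre h k : ℚ) + σ)| :=
          intervalIntegral.integral_const_mul _ _
  -- Step 3: the model parts sum to `dotQ E W`
  have hmodel : ∑ k ∈ Finset.range N, ∑ j ∈ Finset.range E.length, ((E.getD j 0 : ℚ) : ℝ) *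
      ((momAux (Ps.getD k []) (panelCentre h k - h) (panelCentre h k + h) (j + 1) : ℚ) : ℝ) = ((dotQ E W : ℚ) : ℝ) := by
    rw [Finset.sum_comm, dotQ_eq_sum E W hlen]
    push_cast
    refine Finset.sum_congr rfl fun j hj ↦ ?_
    rw [Finset.mem_range] at hj
    rw [← Finset.mul_sum, hW j (lt_of_lt_of_le hj hlen)]
    push_cast
    rfl
  -- Step 4: `Σ_k ∫|E(c_k+σ)| = ∫₀²|E| ≤ r`
  have habs' : ∑ k ∈ Finset.range N, ∫ σ in (-(h:ℝ))..h, |Poly.eval E ((panelCentre h k : ℚ) + σ)| =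
      ∫ τ in (0:ℝ)..2, |Poly.eval E τ| := by
    rw [habs]
    refine Finset.sum_congr rfl fun k _ ↦ integral_congr fun σ _ ↦ ?_
    simp only [hc k]
  have hr := integral_abs_le_of_sq E hr0 hr2
  -- Step 5: combine
  have htot : |(∫ τ in (0:ℝ)..2, weilArchDensityG ((s : ℝ) * τ) * Poly.eval E τ) - ((dotQ E W : ℚ) : ℝ)| ≤
      (G : ℝ) / S * r := by
    rw [hdec, ← hmodel, ← Finset.sum_sub_distrib]
    refine le_trans (Finset.abs_sum_le_sum_abs _ _) ?_
    refine le_trans (Finset.sum_le_sum hpanel) ?_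
    rw [← Finset.mul_sum, habs']
    exact mul_le_mul_of_nonneg_left hr hG0
  have hloR : ((Xlo : ℚ) : ℝ) + (G : ℝ) / S * r ≤ ((dotQ E W : ℚ) : ℝ) := by exact_mod_cast hlo
  have hhiR : ((dotQ E W : ℚ) : ℝ) + (G : ℝ) / S * r ≤ ((Xhi : ℚ) : ℝ) := by exact_mod_cast hhi
  constructor <;> linarith [(abs_le.1 htot).1, (abs_le.1 htot).2]

/-- **Kernel-certified enclosure of the archimedean energy of a scaled window polynomial, moment form** — the
drop-in replacement of `dt_archEnergy_windowPolyY_mem`: the `N` per-panel certificates are replaced by the cell's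
shared facts (`hg`, `hG`, `hPs`, `hW`) and ONE `archMomentCheck` of the polynomial. [cite: Bombieri2000Weil, Thm 2] -/
theorem dt_archEnergy_windowPolyY_mem_moments (P E : Poly) {b : ℚ} (hb : 0 < b) (hb2 : b ≤ 2)
    (hE : ∀ τ : ℝ, τ * Poly.eval E τ =
      Poly.eval (Poly.smul 2 (Poly.corr P P 1)) 0 - Poly.eval (Poly.smul 2 (Poly.corr P P 1)) τ)
    {S : ℕ} (hS : 0 < S) {N : ℕ} (hN : 0 < N) {D K Kφ lam Ke ke : ℕ} (hK : 0 < K) (hKφ : 0 < Kφ) (hlam : 0 < lam)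
    (Q : ℕ → List ℤ) (e : ℕ → ℕ) (ps : ℕ → Poly)
    (hg : ∀ k, k < N → gPanelCheck S (1 / N) D Kφ lam Ke ke (b * panelCentre (1 / N) k) b (Q k) (e k) = true)
    {G : ℚ} (hG : ∀ k, k < N → ((tabsI S (1 / N) (tsubI (gPanelI S (1 / N) D K Ke ke (b * panelCentre (1 / N) k) b
      (Q k) (e k)) (ratPolyI S (ps k))) : ℤ) : ℚ) ≤ G)
    {Ps : List Poly} (hPs : ∀ k, k < N → Ps.getD k [] = Poly.taylorShiftH (ps k) (-panelCentre (1 / N) k))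
    {W : List ℚ} (hW : ∀ j, j < W.length → W.getD j 0 = ∑ k ∈ Finset.range N,
      momAux (Ps.getD k []) (panelCentre (1 / N) k - 1 / N) (panelCentre (1 / N) k + 1 / N) (j + 1))
    {r Xlo Xhi : ℚ} (hchk : archMomentCheck W G S E r Xlo Xhi = true)
    {KeT keT M : ℕ} (htail : archTailCheck S KeT keT M b = true) :
    ((b * Xlo + 2 * (b * integPolyQ P P 1) * (archTailBounds S KeT keT M b).1 : ℚ) : ℝ) ≤
        ∫ t in Set.Ioi 0, weilArchDensity t *
          weilIncrement (fun x : ℝ ↦ (((Set.Icc (-(b : ℝ)) b).indicator (fun x ↦ Poly.eval P (x / b)) x : ℝ) : ℂ)) t ∧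
      ∫ t in Set.Ioi 0, weilArchDensity t *
          weilIncrement (fun x : ℝ ↦ (((Set.Icc (-(b : ℝ)) b).indicator (fun x ↦ Poly.eval P (x / b)) x : ℝ) : ℂ)) t ≤
        ((b * Xhi + 2 * (b * integPolyQ P P 1) * (archTailBounds S KeT keT M b).2 : ℚ) : ℝ) := by
  obtain ⟨hXlo, hXhi⟩ := integral_mem_of_archMomentCheck hS hN hb hb2 hK hKφ hlam Q e ps hg hG hPs hW hchk
  obtain ⟨hTlo, hThi⟩ := archTail_sound hS hb htail
  rw [(EvenWinsBeyondArch.dt_archEnergy_windowPolyY_eq P E hb hE).2]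
  have hbr : (0 : ℝ) < b := by exact_mod_cast hb
  have hG' : (0 : ℝ) ≤ ((integPolyQ P P 1 : ℚ) : ℝ) := by
    have h := EvenWinsBeyondArch.dt_normSq_windowPolyY_eq P hb
    have hnn : (0 : ℝ) ≤ ∫ x in (-(b : ℝ))..b, Poly.eval P (x / b) ^ 2 :=
      intervalIntegral.integral_nonneg (by linarith) fun x _ ↦ sq_nonneg _
    rw [h] at hnn
    nlinarith
  set X := ∫ τ in (0 : ℝ)..2, weilArchDensityG ((b : ℝ) * τ) * Poly.eval E τ with hX
  set T := ∫ t in Set.Ioi (2 * (b : ℝ)), weilArchDensity t with hT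
  have hG2 : (0 : ℝ) ≤ 2 * ((b : ℝ) * ((integPolyQ P P 1 : ℚ) : ℝ)) := by positivity
  have hGT1 : 2 * ((b : ℝ) * ((integPolyQ P P 1 : ℚ) : ℝ)) * (((archTailBounds S KeT keT M b).1 : ℚ) : ℝ) ≤
      2 * ((b : ℝ) * ((integPolyQ P P 1 : ℚ) : ℝ)) * T := mul_le_mul_of_nonneg_left hTlo hG2
  have hGT2 : 2 * ((b : ℝ) * ((integPolyQ P P 1 : ℚ) : ℝ)) * T ≤
      2 * ((b : ℝ) * ((integPolyQ P P 1 : ℚ) : ℝ)) * (((archTailBounds S KeT keT M b).2 : ℚ) : ℝ) :=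
    mul_le_mul_of_nonneg_left hThi hG2
  have hbX1 : (b : ℝ) * (Xlo : ℝ) ≤ (b : ℝ) * X := mul_le_mul_of_nonneg_left hXlo hbr.le
  have hbX2 : (b : ℝ) * X ≤ (b : ℝ) * (Xhi : ℝ) := mul_le_mul_of_nonneg_left hXhi hbr.le
  push_cast at hbX1 hbX2 ⊢
  constructor <;> linarith

end Summit.RiemannHypothesis.RiemannHypothesis.Theorems.ArchMoments
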